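import Mathlib
import Summits.Ventures.PercRepro2.TB14DomZFree

/-!
# Row 2′TB: the mark-free sources and targets are equinumerous at the all-free profile
(blind cell PercRepro2, mine-c g22, 2026-08-26; `conjectures/MINE-C.md` §31)

At the all-free profile the colour swap `flipOn F` (an involution, `flipOn_flipOn'`) exchanges the
mark-free sources `{Q, o ∈ C_red(a₂) ∖ C_blue(a₂)}` and the mark-free targets
`{Q, o ∈ C_blue(a₂) ∖ C_red(a₂)}` (`isTgt_flipOn_of_isSrc`, `isSrc_flipOn_of_isTgt`), so
`#srcSet = #tgtSet` for the mark `b = a₁` (`card_srcSet_free_eq_card_tgtSet_free`).  Hence Hall's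
condition for the release moves of the mark-free sources (`DomZReleaseFree`) asks for a PERFECT
matching of the sources onto the targets — the census statement of the seat's codes (sources =
targets in every fibre, 0 Hall failures).  Own work; standard axioms.
-/

namespace Summit.Ventures.PercRepro2

namespace TB14DomZSwap

open CovForm A3InactiveTyped TB14Fold TB14FlipFamily TB14Hall TB14DomZ TB14DomZFree

section Swap

variable {V : Type} {E : Type} [DecidableEq E]
variable (ends : E → Sym2 V) (a₁ a₂ o : V) (F : Finset E)

/-- The colour swap is an involution (the root `flipOn` of the cell's vocabulary). -/
lemma flipOn_flipOn' (y : Config E) :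
    Summit.Ventures.PercRepro2.flipOn F (Summit.Ventures.PercRepro2.flipOn F y) = y := by
  funext e
  by_cases he : e ∈ F <;> simp [Summit.Ventures.PercRepro2.flipOn, he]

/-- The swap of a mark-free source is a mark-free target. -/
lemma isTgt_flipOn_of_isSrc {y : Config E} (hs : IsSrc ends a₁ a₂ a₁ o F y) :
    IsTgt ends a₁ a₂ a₁ o F (Summit.Ventures.PercRepro2.flipOn F y) := by
  refine ⟨hs.q₂, ?_, conn_refl ends _ a₁, ?_, hs.ho'⟩
  · rw [flipOn_flipOn']; exact hs.q₁
  · rw [flipOn_flipOn']; exact hs.ho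

/-- The swap of a mark-free target is a mark-free source. -/
lemma isSrc_flipOn_of_isTgt {y : Config E} (ht : IsTgt ends a₁ a₂ a₁ o F y) :
    IsSrc ends a₁ a₂ a₁ o F (Summit.Ventures.PercRepro2.flipOn F y) := by
  refine ⟨ht.q₂, ?_, conn_refl ends _ a₁, ht.ho, ?_⟩
  · rw [flipOn_flipOn']; exact ht.q₁
  · rw [flipOn_flipOn']; exact ht.ho'

end Swap

section Card

variable {V : Type} {E : Type} [Fintype E] [DecidableEq E]
variable (ends : E → Sym2 V) (a₁ a₂ o : V) (F : Finset E) (z : Config E)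

open Classical in
/-- At the all-free profile the swap maps the mark-free sources into the mark-free targets. -/
lemma flipOn_mem_tgtSet_of_mem_srcSet (hF : ∀ e, e ∈ F) {y : Config E}
    (hy : y ∈ srcSet ends a₁ a₂ a₁ o F z) : Summit.Ventures.PercRepro2.flipOn F y ∈ tgtSet ends a₁ a₂ a₁ o F z := by
  rw [srcSet, Finset.mem_filter] at hy
  rw [tgtSet, Finset.mem_filter]
  exact ⟨Finset.mem_univ _, adm_of_allFree F z hF _,
    isTgt_flipOn_of_isSrc ends a₁ a₂ o F hy.2.2⟩

open Classical in
/-- At the all-free profile the swap maps the mark-free targets into the mark-free sources. -/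
lemma flipOn_mem_srcSet_of_mem_tgtSet (hF : ∀ e, e ∈ F) {y : Config E}
    (hy : y ∈ tgtSet ends a₁ a₂ a₁ o F z) : Summit.Ventures.PercRepro2.flipOn F y ∈ srcSet ends a₁ a₂ a₁ o F z := by
  rw [tgtSet, Finset.mem_filter] at hy
  rw [srcSet, Finset.mem_filter]
  exact ⟨Finset.mem_univ _, adm_of_allFree F z hF _,
    isSrc_flipOn_of_isTgt ends a₁ a₂ o F hy.2.2⟩

open Classical in
/-- **The mark-free sources and targets are equinumerous at the all-free profile** (the colour
swap is a bijection between them). -/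
theorem card_srcSet_free_eq_card_tgtSet_free (hF : ∀ e, e ∈ F) :
    (srcSet ends a₁ a₂ a₁ o F z).card = (tgtSet ends a₁ a₂ a₁ o F z).card := by
  apply le_antisymm
  · refine Finset.card_le_card_of_injOn (Summit.Ventures.PercRepro2.flipOn F) ?_ ?_
    · intro y hy
      rw [Finset.mem_coe] at hy ⊢
      exact flipOn_mem_tgtSet_of_mem_srcSet ends a₁ a₂ o F z hF hy
    · intro y _ y' _ h
      have := congrArg (Summit.Ventures.PercRepro2.flipOn F) h
      rwa [flipOn_flipOn', flipOn_flipOn'] at this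
  · refine Finset.card_le_card_of_injOn (Summit.Ventures.PercRepro2.flipOn F) ?_ ?_
    · intro y hy
      rw [Finset.mem_coe] at hy ⊢
      exact flipOn_mem_srcSet_of_mem_tgtSet ends a₁ a₂ o F z hF hy
    · intro y _ y' _ h
      have := congrArg (Summit.Ventures.PercRepro2.flipOn F) h
      rwa [flipOn_flipOn', flipOn_flipOn'] at this

end Card

end TB14DomZSwap

end Summit.Ventures.PercRepro2
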